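import Summits.CriticalPhenomena.CardyFormulaZ2.Theses.CardySelfRefinement
import Summits.CriticalPhenomena.CardyFormulaZ2.Theorems.CardySelfRefinementLagHandOffDiscreteLocalityPatch
import Summits.CriticalPhenomena.CardyFormulaZ2.Theorems.CardySelfRefinementLagHandOffDiscreteSplittingOfLabelling
import HarnessLib

/-!
# Exact lattice locality for nested domains: stub `stub_discreteLocality` (R3a) of line
`hitting-tournament` for crux `LagHandOff` (stmt-CriticalPhenomena-10268)

`stub_discreteLocality`: nested Dobrushin (Jordan) domains `D' ⊆ D` with the same marked points
`a = pt 0`, `b = pt 1` either have `a ∈ closure (D ∖ D')`, or carry admissible `ℤ²`-discretisation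
families `E` of `D` and `E'` of a Dobrushin structure `D''` on `(D'.carrier; a, b)` whose
bond-percolation interfaces, at every small mesh and for EVERY configuration, coincide or share a
common parametrised prefix ending `ρ`-close to `closure (D ∖ D')`.

PROOF (mirror of the twin R3b, `…DiscreteSplitting.lean`).
* Plane topology (`…DiscreteLocalityArcs.lean`, `exists_arcCompatible'`): the orientation of `D'` is
  chosen (`D''`) so that off `closure (D ∖ D') ∪ {a, b}` the arc `(ab)` of `D` lies on the arc `(ab)`
  of `D''` and misses its arc `(ba)`, and symmetrically — Newman's cross-cut theorem for nested
  Jordan domains (`JordanDomain.not_separated_of_nested`).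
* Lattice locality (`…DiscreteLocalityLattice.lean`): far from `F = closure (D ∖ D'')` the canonical
  discrete domains `Ω_δ(D)`, `Ω_δ(D'')`, their inner faces and square-lattice boundaries agree; far
  sites of `Ω_δ(D)` lie in `Ω_δ(D'')` for all small meshes (the largest-component discretisation is
  the bulk, `MeshDomainJordan.lean`, and macroscopic components are the bulk,
  `MeshDomainBigComponents.lean`).
* Labellings (`…DiscreteLocalityPatchCut/Patch.lean`, `locality_families` below): the labelling of `eventually_labelling`
  for `D` is PATCHED onto `Ω_δ(D'')` — `D`'s labels at the sites `θ`-far from `F`, `D''`'s own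
  labels elsewhere — at a common tolerance small against the separation of the two arcs away from
  `a, b` (`…DiscreteLocalityGeometry.lean`); the patched labelling is again admissible with the
  common cut edge `e_a`; a diagonal tolerance `η δ → 0` and the marker reduction with identified
  arcs (`zdDiscretisationFamily_of_labelling_arcs`) give the two families.
* One mesh (`…DiscreteLocalityMesh.lean`, `locality_at_mesh`): the two completed configurations of
  ANY `ω` agree at the far sites, the start (or end) corner at `e_a` is common, and lead-0's
  deterministic prefix / suffix theorems (`bondInterfaceIn_eq_or_commonPrefix`, `…_rev`) give
  equality or a common parametrised prefix ending within `η δ + 5δ ≤ ρ` of `F`.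

## Two compatible admissible families for nested domains (`locality_families`)

From the compatible labellings at every small mesh and every tolerance (`locality_labels`,
`…DiscreteLocalityPatch.lean`), a
DIAGONAL tolerance `η δ → 0⁺` (the infimum trick of `stub_discretisable`) and lead-0's marker
reduction with identified arcs (`zdDiscretisationFamily_of_labelling_arcs`) produce an admissible
`ℤ²`-discretisation family of the big domain `D` and one of the compatibly oriented small domain
`D''` whose discrete domains and discrete arcs agree at every site `θ δ`-far from the removed part
(`θ δ ≤ η δ`), and which share the `A`–`B` edge `e_a` at every small mesh (`locality_families`).
-/

noncomputable section

open MeasureTheory Filter Set Topology Metric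
open scoped unitInterval BoundedContinuousFunction
open Literature.Probability.Percolation Literature.Probability.LatticeModels
open Literature.Probability.RandomPlanarGeometry Literature.Probability.Percolation.QuadCrossing

namespace Summit.CriticalPhenomena.CardyFormulaZ2.Cruxes.LagHandOff.HittingTournament

-- adapted from Theorems/CardySusyWardDiscretisationFamilyExists.lean (`exists_tendsto_of_forall_eventually`;
-- private copy, as in Theorems/CardyFlipRussoTargetStubVoronoiGrid.lean, to keep the import cone small)
/-- **The infimum trick.** If a property of meshes and tolerances holds, for every positive
tolerance, at all small meshes, then it holds at all small meshes along some positive tolerance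
function tending to `0`. -/
private theorem exists_tendsto_of_forall_eventually {P : ℝ → ℝ → Prop}
    (hev : ∀ η : ℝ, 0 < η → ∀ᶠ δ in 𝓝[>] (0 : ℝ), P δ η) :
    ∃ ε : ℝ → ℝ, Tendsto ε (𝓝[>] 0) (𝓝 0) ∧ ∀ᶠ δ in 𝓝[>] (0 : ℝ), 0 < ε δ ∧ P δ (ε δ) := by
  classical
  set G : ℝ → Set ℝ := fun δ => {η | 0 < η ∧ P δ η} with hG
  have hbdd : ∀ δ, BddBelow (G δ) := fun δ => ⟨0, fun η hη => hη.1.le⟩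
  set ε : ℝ → ℝ := fun δ =>
    if hx : ∃ η, η ∈ G δ ∧ η < sInf (G δ) + δ then Classical.choose hx else 1 with hεd
  have hmem : ∀ η : ℝ, 0 < η → ∀ᶠ δ in 𝓝[>] (0 : ℝ), η ∈ G δ := fun η hη =>
    (hev η hη).mono fun δ hδ => ⟨hη, hδ⟩
  have hpos : ∀ᶠ δ in 𝓝[>] (0 : ℝ), 0 < δ := self_mem_nhdsWithin
  have hchoice : ∀ᶠ δ in 𝓝[>] (0 : ℝ), ε δ ∈ G δ ∧ ε δ < sInf (G δ) + δ := by
    filter_upwards [hmem 1 one_pos, hpos] with δ h1 hδ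
    have hx : ∃ η, η ∈ G δ ∧ η < sInf (G δ) + δ := by
      obtain ⟨η, hη, hlt⟩ := exists_lt_of_csInf_lt ⟨1, h1⟩ (lt_add_of_pos_right _ hδ)
      exact ⟨η, hη, hlt⟩
    have : ε δ = Classical.choose hx := by rw [hεd]; exact dif_pos hx
    rw [this]
    exact Classical.choose_spec hx
  refine ⟨ε, ?_, hchoice.mono fun δ hδ => ⟨hδ.1.1, hδ.1.2⟩⟩
  rw [Metric.tendsto_nhds]
  intro e he
  filter_upwards [hchoice, hmem (e / 2) (by positivity),
    Ioo_mem_nhdsGT (show (0 : ℝ) < e / 2 by positivity)] with δ hc h2 hδ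
  have hinf : sInf (G δ) ≤ e / 2 := csInf_le (hbdd δ) h2
  rw [Real.dist_eq, sub_zero, abs_of_pos hc.1.1]
  linarith [hc.2, hδ.2]

set_option maxHeartbeats 3200000 in
/-- **Two compatible admissible families.** See the module docstring. -/
theorem locality_families (D D'' : DobrushinDomain) (hsub : D''.carrier ⊆ D.carrier)
    (h0 : D''.pt 0 = D.pt 0) (h1 : D''.pt 1 = D.pt 1)
    (hA0 : ∀ z ∈ D.arc 0, z ∉ closure (D.carrier \ D''.carrier) → z ∈ D''.arc 0)
    (hA1 : ∀ z ∈ D.arc 1, z ∉ closure (D.carrier \ D''.carrier) → z ∈ D''.arc 1)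
    (ha : D.pt 0 ∉ closure (D.carrier \ D''.carrier)) :
    ∃ (A₁ B₁ A₂ B₂ : ℝ → Set ℂ) (η : ℝ → ℝ),
      ZdDiscretisationFamily D'' (fun δ => (⟨D''.carrier, δ, A₁ δ, B₁ δ⟩ : DiscreteDobrushin)) ∧
      ZdDiscretisationFamily D (fun δ => (⟨D.carrier, δ, A₂ δ, B₂ δ⟩ : DiscreteDobrushin)) ∧
      Tendsto η (𝓝[>] 0) (𝓝 0) ∧
      ∀ᶠ δ in 𝓝[>] (0 : ℝ), ∃ θ : ℝ, 0 ≤ θ ∧ θ ≤ η δ ∧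
        (∀ v : Site 2, (∀ z ∈ closure (D.carrier \ D''.carrier), θ ≤ dist (meshPoint δ v) z) →
          (v ∈ meshDomain D.carrier δ ↔ v ∈ meshDomain D''.carrier δ)) ∧
        (∀ v : Site 2, (∀ z ∈ closure (D.carrier \ D''.carrier), θ ≤ dist (meshPoint δ v) z) →
          (v ∈ (⟨D''.carrier, δ, A₁ δ, B₁ δ⟩ : DiscreteDobrushin).zdArcA ↔
            v ∈ (⟨D.carrier, δ, A₂ δ, B₂ δ⟩ : DiscreteDobrushin).zdArcA)) ∧
        (∀ v : Site 2, (∀ z ∈ closure (D.carrier \ D''.carrier), θ ≤ dist (meshPoint δ v) z) →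
          (v ∈ (⟨D''.carrier, δ, A₁ δ, B₁ δ⟩ : DiscreteDobrushin).zdArcB ↔
            v ∈ (⟨D.carrier, δ, A₂ δ, B₂ δ⟩ : DiscreteDobrushin).zdArcB)) ∧
        ∃ ea eb₁ eb₂ : Sym2 (Site 2),
          (⟨D''.carrier, δ, A₁ δ, B₁ δ⟩ : DiscreteDobrushin).zdABEdges = {ea, eb₁} ∧
          (⟨D.carrier, δ, A₂ δ, B₂ δ⟩ : DiscreteDobrushin).zdABEdges = {ea, eb₂} ∧
          (∀ x ∈ ea, ∀ z ∈ closure (D.carrier \ D''.carrier), θ + 4 * δ ≤ dist (meshPoint δ x) z) ∧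
          dist (medialPoint δ ea) (D.pt 0) ≤ η δ ∧ dist (medialPoint δ eb₁) (D.pt 1) ≤ η δ ∧
          dist (medialPoint δ eb₂) (D.pt 1) ≤ η δ := by
  classical
  -- the property at mesh `δ` and tolerance `η`, over one tuple of the four label classes
  set Pr : ℝ → ℝ → Prop := fun δ η => ∃ L : (Set (Site 2) × Set (Site 2)) × (Set (Site 2) × Set (Site 2)),
      (L.1.1 ∪ L.1.2 = (⟨D.carrier, δ, ∅, ∅⟩ : DiscreteDobrushin).zdBoundary ∧
        Disjoint L.1.1 L.1.2 ∧ L.1.1.Nonempty ∧ L.1.2.Nonempty ∧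
        (∀ y ∈ L.1.1, ¬ closedBall (meshPoint δ y) (infDist (meshPoint δ y) (frontier D.carrier)) ⊆
          ⋃ x ∈ L.1.2, closedBall (meshPoint δ x) (infDist (meshPoint δ x) (frontier D.carrier))) ∧
        (∀ x ∈ L.1.2, ¬ closedBall (meshPoint δ x) (infDist (meshPoint δ x) (frontier D.carrier)) ⊆
          ⋃ y ∈ L.1.1, closedBall (meshPoint δ y) (infDist (meshPoint δ y) (frontier D.carrier))) ∧
        (∀ y ∈ L.1.1, infDist (meshPoint δ y) (D.arc 0) ≤ η) ∧
        (∀ x ∈ L.1.2, infDist (meshPoint δ x) (D.arc 1) ≤ η) ∧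
        {e | e ∈ (discreteDomainGraph D.carrier δ).edgeSet ∧ (∃ x ∈ e, x ∈ L.1.1) ∧ ∃ y ∈ e, y ∈ L.1.2}.ncard = 2 ∧
        ∀ e ∈ (discreteDomainGraph D.carrier δ).edgeSet, (∃ x ∈ e, x ∈ L.1.1) → (∃ y ∈ e, y ∈ L.1.2) →
          ∃! f, (⟨D.carrier, δ, ∅, ∅⟩ : DiscreteDobrushin).IsInnerFace f ∧ ∀ x ∈ e, IsCorner x f) ∧
      hausdorffEDist (medialPoint δ ''
        {e | e ∈ (discreteDomainGraph D.carrier δ).edgeSet ∧ (∃ x ∈ e, x ∈ L.1.1) ∧ ∃ y ∈ e, y ∈ L.1.2})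
        {D.pt 0, D.pt 1} ≤ ENNReal.ofReal η ∧
      (L.2.1 ∪ L.2.2 = (⟨D''.carrier, δ, ∅, ∅⟩ : DiscreteDobrushin).zdBoundary ∧
        Disjoint L.2.1 L.2.2 ∧ L.2.1.Nonempty ∧ L.2.2.Nonempty ∧
        (∀ y ∈ L.2.1, ¬ closedBall (meshPoint δ y) (infDist (meshPoint δ y) (frontier D''.carrier)) ⊆
          ⋃ x ∈ L.2.2, closedBall (meshPoint δ x) (infDist (meshPoint δ x) (frontier D''.carrier))) ∧
        (∀ x ∈ L.2.2, ¬ closedBall (meshPoint δ x) (infDist (meshPoint δ x) (frontier D''.carrier)) ⊆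
          ⋃ y ∈ L.2.1, closedBall (meshPoint δ y) (infDist (meshPoint δ y) (frontier D''.carrier))) ∧
        (∀ y ∈ L.2.1, infDist (meshPoint δ y) (D''.arc 0) ≤ η) ∧
        (∀ x ∈ L.2.2, infDist (meshPoint δ x) (D''.arc 1) ≤ η) ∧
        {e | e ∈ (discreteDomainGraph D''.carrier δ).edgeSet ∧ (∃ x ∈ e, x ∈ L.2.1) ∧ ∃ y ∈ e, y ∈ L.2.2}.ncard = 2 ∧
        ∀ e ∈ (discreteDomainGraph D''.carrier δ).edgeSet, (∃ x ∈ e, x ∈ L.2.1) → (∃ y ∈ e, y ∈ L.2.2) →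
          ∃! f, (⟨D''.carrier, δ, ∅, ∅⟩ : DiscreteDobrushin).IsInnerFace f ∧ ∀ x ∈ e, IsCorner x f) ∧
      hausdorffEDist (medialPoint δ ''
        {e | e ∈ (discreteDomainGraph D''.carrier δ).edgeSet ∧ (∃ x ∈ e, x ∈ L.2.1) ∧ ∃ y ∈ e, y ∈ L.2.2})
        {D''.pt 0, D''.pt 1} ≤ ENNReal.ofReal η ∧
      ∃ θ : ℝ, 0 < θ ∧ θ ≤ η ∧
        (∀ v : Site 2, (∀ z ∈ closure (D.carrier \ D''.carrier), θ ≤ dist (meshPoint δ v) z) →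
          (v ∈ meshDomain D.carrier δ ↔ v ∈ meshDomain D''.carrier δ)) ∧
        (∀ v : Site 2, (∀ z ∈ closure (D.carrier \ D''.carrier), θ ≤ dist (meshPoint δ v) z) →
          (v ∈ L.2.1 ↔ v ∈ L.1.1) ∧ (v ∈ L.2.2 ↔ v ∈ L.1.2)) ∧
        ∃ ea eb₁ eb₂ : Sym2 (Site 2),
          {e | e ∈ (discreteDomainGraph D''.carrier δ).edgeSet ∧ (∃ x ∈ e, x ∈ L.2.1) ∧ ∃ y ∈ e, y ∈ L.2.2} = {ea, eb₁} ∧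
          {e | e ∈ (discreteDomainGraph D.carrier δ).edgeSet ∧ (∃ x ∈ e, x ∈ L.1.1) ∧ ∃ y ∈ e, y ∈ L.1.2} = {ea, eb₂} ∧
          (∀ x ∈ ea, ∀ z ∈ closure (D.carrier \ D''.carrier), θ + 4 * δ ≤ dist (meshPoint δ x) z) ∧
          dist (medialPoint δ ea) (D.pt 0) ≤ η ∧ dist (medialPoint δ eb₁) (D.pt 1) ≤ η ∧
          dist (medialPoint δ eb₂) (D.pt 1) ≤ η with hPr
  have hev : ∀ η : ℝ, 0 < η → ∀ᶠ δ in 𝓝[>] (0 : ℝ), Pr δ η := fun η hη =>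
    (locality_labels D D'' hsub h0 h1 hA0 hA1 ha hη).mono fun δ ⟨SA, SB, P, Q, h⟩ => ⟨((SA, SB), (P, Q)), h⟩
  -- the diagonal tolerance
  obtain ⟨η, hη, hgood⟩ := exists_tendsto_of_forall_eventually hev
  -- the labels at the diagonal tolerance
  set L : ℝ → (Set (Site 2) × Set (Site 2)) × (Set (Site 2) × Set (Site 2)) := fun δ =>
    if hx : Pr δ (η δ) then Classical.choose hx else ((∅, ∅), (∅, ∅)) with hLd
  set SA : ℝ → Set (Site 2) := fun δ => (L δ).1.1 with hSAd
  set SB : ℝ → Set (Site 2) := fun δ => (L δ).1.2 with hSBd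
  set P : ℝ → Set (Site 2) := fun δ => (L δ).2.1 with hPd
  set Q : ℝ → Set (Site 2) := fun δ => (L δ).2.2 with hQd
  have hspec : ∀ᶠ δ in 𝓝[>] (0 : ℝ),
      ((SA δ) ∪ (SB δ) = (⟨D.carrier, δ, ∅, ∅⟩ : DiscreteDobrushin).zdBoundary ∧
        Disjoint (SA δ) (SB δ) ∧ (SA δ).Nonempty ∧ (SB δ).Nonempty ∧
        (∀ y ∈ (SA δ), ¬ closedBall (meshPoint δ y) (infDist (meshPoint δ y) (frontier D.carrier)) ⊆
          ⋃ x ∈ (SB δ), closedBall (meshPoint δ x) (infDist (meshPoint δ x) (frontier D.carrier))) ∧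
        (∀ x ∈ (SB δ), ¬ closedBall (meshPoint δ x) (infDist (meshPoint δ x) (frontier D.carrier)) ⊆
          ⋃ y ∈ (SA δ), closedBall (meshPoint δ y) (infDist (meshPoint δ y) (frontier D.carrier))) ∧
        (∀ y ∈ (SA δ), infDist (meshPoint δ y) (D.arc 0) ≤ (η δ)) ∧
        (∀ x ∈ (SB δ), infDist (meshPoint δ x) (D.arc 1) ≤ (η δ)) ∧
        {e | e ∈ (discreteDomainGraph D.carrier δ).edgeSet ∧ (∃ x ∈ e, x ∈ (SA δ)) ∧ ∃ y ∈ e, y ∈ (SB δ)}.ncard = 2 ∧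
        ∀ e ∈ (discreteDomainGraph D.carrier δ).edgeSet, (∃ x ∈ e, x ∈ (SA δ)) → (∃ y ∈ e, y ∈ (SB δ)) →
          ∃! f, (⟨D.carrier, δ, ∅, ∅⟩ : DiscreteDobrushin).IsInnerFace f ∧ ∀ x ∈ e, IsCorner x f) ∧
      hausdorffEDist (medialPoint δ ''
        {e | e ∈ (discreteDomainGraph D.carrier δ).edgeSet ∧ (∃ x ∈ e, x ∈ (SA δ)) ∧ ∃ y ∈ e, y ∈ (SB δ)})
        {D.pt 0, D.pt 1} ≤ ENNReal.ofReal (η δ) ∧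
      ((P δ) ∪ (Q δ) = (⟨D''.carrier, δ, ∅, ∅⟩ : DiscreteDobrushin).zdBoundary ∧
        Disjoint (P δ) (Q δ) ∧ (P δ).Nonempty ∧ (Q δ).Nonempty ∧
        (∀ y ∈ (P δ), ¬ closedBall (meshPoint δ y) (infDist (meshPoint δ y) (frontier D''.carrier)) ⊆
          ⋃ x ∈ (Q δ), closedBall (meshPoint δ x) (infDist (meshPoint δ x) (frontier D''.carrier))) ∧
        (∀ x ∈ (Q δ), ¬ closedBall (meshPoint δ x) (infDist (meshPoint δ x) (frontier D''.carrier)) ⊆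
          ⋃ y ∈ (P δ), closedBall (meshPoint δ y) (infDist (meshPoint δ y) (frontier D''.carrier))) ∧
        (∀ y ∈ (P δ), infDist (meshPoint δ y) (D''.arc 0) ≤ (η δ)) ∧
        (∀ x ∈ (Q δ), infDist (meshPoint δ x) (D''.arc 1) ≤ (η δ)) ∧
        {e | e ∈ (discreteDomainGraph D''.carrier δ).edgeSet ∧ (∃ x ∈ e, x ∈ (P δ)) ∧ ∃ y ∈ e, y ∈ (Q δ)}.ncard = 2 ∧
        ∀ e ∈ (discreteDomainGraph D''.carrier δ).edgeSet, (∃ x ∈ e, x ∈ (P δ)) → (∃ y ∈ e, y ∈ (Q δ)) →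
          ∃! f, (⟨D''.carrier, δ, ∅, ∅⟩ : DiscreteDobrushin).IsInnerFace f ∧ ∀ x ∈ e, IsCorner x f) ∧
      hausdorffEDist (medialPoint δ ''
        {e | e ∈ (discreteDomainGraph D''.carrier δ).edgeSet ∧ (∃ x ∈ e, x ∈ (P δ)) ∧ ∃ y ∈ e, y ∈ (Q δ)})
        {D''.pt 0, D''.pt 1} ≤ ENNReal.ofReal (η δ) ∧
      ∃ θ : ℝ, 0 < θ ∧ θ ≤ (η δ) ∧
        (∀ v : Site 2, (∀ z ∈ closure (D.carrier \ D''.carrier), θ ≤ dist (meshPoint δ v) z) →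
          (v ∈ meshDomain D.carrier δ ↔ v ∈ meshDomain D''.carrier δ)) ∧
        (∀ v : Site 2, (∀ z ∈ closure (D.carrier \ D''.carrier), θ ≤ dist (meshPoint δ v) z) →
          (v ∈ (P δ) ↔ v ∈ (SA δ)) ∧ (v ∈ (Q δ) ↔ v ∈ (SB δ))) ∧
        ∃ ea eb₁ eb₂ : Sym2 (Site 2),
          {e | e ∈ (discreteDomainGraph D''.carrier δ).edgeSet ∧ (∃ x ∈ e, x ∈ (P δ)) ∧ ∃ y ∈ e, y ∈ (Q δ)} = {ea, eb₁} ∧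
          {e | e ∈ (discreteDomainGraph D.carrier δ).edgeSet ∧ (∃ x ∈ e, x ∈ (SA δ)) ∧ ∃ y ∈ e, y ∈ (SB δ)} = {ea, eb₂} ∧
          (∀ x ∈ ea, ∀ z ∈ closure (D.carrier \ D''.carrier), θ + 4 * δ ≤ dist (meshPoint δ x) z) ∧
          dist (medialPoint δ ea) (D.pt 0) ≤ (η δ) ∧ dist (medialPoint δ eb₁) (D.pt 1) ≤ (η δ) ∧
          dist (medialPoint δ eb₂) (D.pt 1) ≤ (η δ) := by
    filter_upwards [hgood] with δ hδ
    obtain ⟨-, hx⟩ := hδ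
    have hL : L δ = Classical.choose hx := by rw [hLd]; exact dif_pos hx
    have h := Classical.choose_spec hx
    simp only [hSAd, hSBd, hPd, hQd, hL]
    exact h
  -- the two families, by the marker reduction with identified arcs
  have hup : Tendsto (fun δ => ENNReal.ofReal (η δ)) (𝓝[>] 0) (𝓝 0) := by
    rw [← ENNReal.ofReal_zero]; exact ENNReal.tendsto_ofReal hη
  obtain ⟨A₂, B₂, hfam, hid⟩ := zdDiscretisationFamily_of_labelling_arcs D SA SB η hη
    (hspec.mono fun δ h => h.1)
    (tendsto_of_tendsto_of_tendsto_of_le_of_le' tendsto_const_nhds hup (Eventually.of_forall fun _ => zero_le)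
      (hspec.mono fun δ h => h.2.1))
  obtain ⟨A₁, B₁, hfam'', hid''⟩ := zdDiscretisationFamily_of_labelling_arcs D'' P Q η hη
    (hspec.mono fun δ h => h.2.2.1)
    (tendsto_of_tendsto_of_tendsto_of_le_of_le' tendsto_const_nhds hup (Eventually.of_forall fun _ => zero_le)
      (hspec.mono fun δ h => h.2.2.2.1))
  refine ⟨A₁, B₁, A₂, B₂, η, hfam'', hfam, hη, ?_⟩
  filter_upwards [hspec, hid, hid''] with δ h hi hi''
  obtain ⟨-, -, -, -, θ, hθ0, hθη, hMM, hagree, ea, eb₁, eb₂, hcut'', hcut, hfar, hea, heb₁, heb₂⟩ := h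
  have hA'' : (⟨D''.carrier, δ, A₁ δ, B₁ δ⟩ : DiscreteDobrushin).zdArcA = P δ := hi''.1
  have hB'' : (⟨D''.carrier, δ, A₁ δ, B₁ δ⟩ : DiscreteDobrushin).zdArcB = Q δ := hi''.2
  have hA : (⟨D.carrier, δ, A₂ δ, B₂ δ⟩ : DiscreteDobrushin).zdArcA = SA δ := hi.1
  have hB : (⟨D.carrier, δ, A₂ δ, B₂ δ⟩ : DiscreteDobrushin).zdArcB = SB δ := hi.2
  have hE'' : (⟨D''.carrier, δ, A₁ δ, B₁ δ⟩ : DiscreteDobrushin).zdABEdges =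
      {e | e ∈ (discreteDomainGraph D''.carrier δ).edgeSet ∧ (∃ x ∈ e, x ∈ P δ) ∧ ∃ y ∈ e, y ∈ Q δ} := by
    ext x
    rw [DiscreteDobrushin.mem_zdABEdges_iff, hA'', hB'']
    rfl
  have hE : (⟨D.carrier, δ, A₂ δ, B₂ δ⟩ : DiscreteDobrushin).zdABEdges =
      {e | e ∈ (discreteDomainGraph D.carrier δ).edgeSet ∧ (∃ x ∈ e, x ∈ SA δ) ∧ ∃ y ∈ e, y ∈ SB δ} := by
    ext x
    rw [DiscreteDobrushin.mem_zdABEdges_iff, hA, hB]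
    rfl
  refine ⟨θ, hθ0.le, hθη, hMM, fun v hv => ?_, fun v hv => ?_, ea, eb₁, eb₂, by rw [hE'', hcut''],
    by rw [hE, hcut], hfar, hea, heb₁, heb₂⟩
  · rw [hA'', hA]; exact (hagree v hv).1
  · rw [hB'', hB]; exact (hagree v hv).2

/-! ### Registered sub-goal (one-line signature, verbatim) -/

/-- **Registered sub-goal `stub_discreteLocality_families` of `stub_discreteLocality`**: two compatible admissible families (`locality_families`), fully
quantified. -/
theorem stub_discreteLocality_families : ∀ (D D'' : DobrushinDomain), (D''.carrier ⊆ D.carrier) → (D''.pt 0 = D.pt 0) → (D''.pt 1 = D.pt 1) → (∀ z ∈ D.arc 0, z ∉ closure (D.carrier \ D''.carrier) → z ∈ D''.arc 0) → (∀ z ∈ D.arc 1, z ∉ closure (D.carrier \ D''.carrier) → z ∈ D''.arc 1) → (D.pt 0 ∉ closure (D.carrier \ D''.carrier)) → ∃ (A₁ B₁ A₂ B₂ : ℝ → Set ℂ) (η : ℝ → ℝ), ZdDiscretisationFamily D'' (fun δ => (⟨D''.carrier, δ, A₁ δ, B₁ δ⟩ : DiscreteDobrushin)) ∧ ZdDiscretisationFamily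 D (fun δ => (⟨D.carrier, δ, A₂ δ, B₂ δ⟩ : DiscreteDobrushin)) ∧ Tendsto η (𝓝[>] 0) (𝓝 0) ∧ ∀ᶠ δ in 𝓝[>] (0 : ℝ), ∃ θ : ℝ, 0 ≤ θ ∧ θ ≤ η δ ∧ (∀ v : Site 2, (∀ z ∈ closure (D.carrier \ D''.carrier), θ ≤ dist (meshPoint δ v) z) → (v ∈ meshDomain D.carrier δ ↔ v ∈ meshDomain D''.carrier δ)) ∧ (∀ v : Site 2, (∀ z ∈ closure (D.carrier \ D''.carrier), θ ≤ dist (meshPoint δ v) z) → (v ∈ (⟨D''.carrier, δ, A₁ δ, B₁ δ⟩ : DiscreteDobrushin).zdArcA ↔ v ∈ (⟨D.carrier, δ, A₂ δ, B₂ δ⟩ : DiscreteDobrushin).zdArcA)) ∧ (∀ v : Site 2, (∀ z ∈ closure (D.carrier \ D''.carrier), θ ≤ dist (meshPoint δ v) z) → (v ∈ (⟨D''.carrier, δ, A₁ δ, B₁ δ⟩ : DiscreteDobrushin).zdArcB ↔ v ∈ (⟨D.carrier, δ, A₂ δ, B₂ δ⟩ : DiscreteDobrushin).zdArcB)) ∧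 ∃ ea eb₁ eb₂ : Sym2 (Site 2), (⟨D''.carrier, δ, A₁ δ, B₁ δ⟩ : DiscreteDobrushin).zdABEdges = {ea, eb₁} ∧ (⟨D.carrier, δ, A₂ δ, B₂ δ⟩ : DiscreteDobrushin).zdABEdges = {ea, eb₂} ∧ (∀ x ∈ ea, ∀ z ∈ closure (D.carrier \ D''.carrier), θ + 4 * δ ≤ dist (meshPoint δ x) z) ∧ dist (medialPoint δ ea) (D.pt 0) ≤ η δ ∧ dist (medialPoint δ eb₁) (D.pt 1) ≤ η δ ∧ dist (medialPoint δ eb₂) (D.pt 1) ≤ η δ :=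
  fun D D'' hsub h0 h1 hA0 hA1 ha => locality_families D D'' hsub h0 h1 hA0 hA1 ha

/-! ### The stub -/

set_option maxHeartbeats 1600000 in
/-- **`stub_discreteLocality` (R3a): exact lattice locality for nested domains.** See the module
docstring. -/
theorem stub_discreteLocality : ∀ D D' : DobrushinDomain, D'.carrier ⊆ D.carrier → D'.pt 0 = D.pt 0 → D'.pt 1 = D.pt 1 → D.pt 0 ∈ closure (D.carrier \ D'.carrier) ∨ ∃ (D'' : DobrushinDomain) (E E' : ℝ → DiscreteDobrushin), D''.carrier = D'.carrier ∧ D''.pt 0 = D'.pt 0 ∧ D''.pt 1 = D'.pt 1 ∧ ZdDiscretisationFamily D E ∧ ZdDiscretisationFamily D'' E' ∧ ∀ ρ : ℝ, 0 < ρ → ∀ᶠ δ in nhdsWithin (0 : ℝ) (Set.Ioi 0), ∀ ω : BondConfig (Site 2), bondInterfaceIn D' (E' δ) ω = bondInterfaceIn D (E δ) ω ∨ ∃ (c c' : Curve ℂ) (s : unitInterval), CurveClass.mk c = bondInterfaceIn D' (E' δ) ω ∧ CurveClass.mk c' = bondInterfaceIn D (E δ) ω ∧ (∀ t : unitInterval,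 t ≤ s → c t = c' t) ∧ c s ∈ Metric.cthickening ρ (closure (D.carrier \ D'.carrier)) := by
  intro D D' hsub h0 h1
  by_cases haF : D.pt 0 ∈ closure (D.carrier \ D'.carrier)
  · exact Or.inl haF
  right
  -- the compatible orientation of the inner domain
  obtain ⟨D'', hc, hp0, hp1, hA0, hA1, -, -⟩ := exists_arcCompatible' D D' hsub h0 h1 haF
  have hsub'' : D''.carrier ⊆ D.carrier := by rw [hc]; exact hsub
  have hF : closure (D.carrier \ D''.carrier) = closure (D.carrier \ D'.carrier) := by rw [hc]
  rw [← hF] at hA0 hA1 haF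
  -- the two compatible families
  obtain ⟨A₁, B₁, A₂, B₂, η, hfam'', hfam, hη, hgood⟩ := locality_families D D'' hsub'' hp0 hp1 hA0 hA1 haF
  refine ⟨D'', fun δ => ⟨D.carrier, δ, A₂ δ, B₂ δ⟩, fun δ => ⟨D''.carrier, δ, A₁ δ, B₁ δ⟩, hc,
    hp0.trans h0.symm, hp1.trans h1.symm, hfam, hfam'', fun ρ hρ => ?_⟩
  -- smallness for all small meshes
  have hab : 0 < dist (D.pt 0) (D.pt 1) := dist_pt_pos D
  set c := min ρ (dist (D.pt 0) (D.pt 1) / 2) with hcd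
  have hc0 : 0 < c := lt_min hρ (by positivity)
  have hsmall : ∀ᶠ δ in 𝓝[>] (0 : ℝ), η δ + 5 * δ < c := by
    have h1 : Tendsto (fun δ : ℝ => η δ + 5 * δ) (𝓝[>] 0) (𝓝 0) := by
      have hδ : Tendsto (fun δ : ℝ => δ) (𝓝[>] (0 : ℝ)) (𝓝 0) := tendsto_nhdsWithin_of_tendsto_nhds tendsto_id
      simpa using hη.add (hδ.const_mul 5)
    exact h1.eventually (gt_mem_nhds hc0)
  have hδpos : ∀ᶠ δ in 𝓝[>] (0 : ℝ), 0 < δ := self_mem_nhdsWithin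
  filter_upwards [hgood, hfam.eventually_isZdAdmissible, hfam''.eventually_isZdAdmissible, hsmall, hδpos]
    with δ hg hEb hEs hs hδ ω
  obtain ⟨θ, hθ0, hθη, hMM, hlabA, hlabB, ea, eb₁, eb₂, hab₁, hab₂, hfar, hea, heb₁, heb₂⟩ := hg
  have hcρ : c ≤ ρ := min_le_left _ _
  have hcab : c ≤ dist (D.pt 0) (D.pt 1) / 2 := min_le_right _ _
  -- the orientation inequalities
  have hoa : dist (medialPoint δ ea) (D.pt 0) ≤ dist (medialPoint δ ea) (D.pt 1) := by
    linarith [dist_triangle (D.pt 0) (medialPoint δ ea) (D.pt 1), dist_comm (D.pt 0) (medialPoint δ ea)]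
  have hob₁ : dist (medialPoint δ eb₁) (D.pt 1) < dist (medialPoint δ eb₁) (D.pt 0) := by
    linarith [dist_triangle (D.pt 0) (medialPoint δ eb₁) (D.pt 1), dist_comm (D.pt 0) (medialPoint δ eb₁)]
  have hob₂ : dist (medialPoint δ eb₂) (D.pt 1) < dist (medialPoint δ eb₂) (D.pt 0) := by
    linarith [dist_triangle (D.pt 0) (medialPoint δ eb₂) (D.pt 1), dist_comm (D.pt 0) (medialPoint δ eb₂)]
  -- the one-mesh locality
  rcases locality_at_mesh D' D h0 h1 hsub'' hδ hθ0 hEs hEb hMM hlabA hlabB hab₁ hab₂ hfar hoa hob₁ hob₂ ω with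
    h | ⟨c₁, c₂, s, h₁, h₂, h₃, h₄⟩
  · exact Or.inl h
  · refine Or.inr ⟨c₁, c₂, s, h₁, h₂, h₃, ?_⟩
    rw [hF] at h₄
    exact Metric.cthickening_mono (by linarith) _ h₄

end Summit.CriticalPhenomena.CardyFormulaZ2.Cruxes.LagHandOff.HittingTournament

end
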